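import Literature.Computability.QuantumComplexity.RevSLP
import HarnessLib

/-!
# Reversible arithmetic gadgets, II′: straight-line programs — step lemmas and compiler correctness

Topic `Literature/Computability/QuantumComplexity`; sequel of `RevSLP.lean` (syntax, interpreter, layouts,
compilation to `NOT`/`CNOT`/Toffoli programs over `ℕ`-numbered wires, the invariant `SLP.Inv`). Here:

* one instruction preserves the invariant — the layer-shaped instructions (`inv_step_setBit`,
  `inv_step_copyIn`, `inv_step_andBit`, `inv_step_fand`, `inv_step_fnot`, `inv_step_forr`: fresh
  distinct targets that are never controls, `clEval_apply_target_of_nodup`) and the two gadget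
  instructions (`inv_step_add`: the ripple-carry adder of `RevArith.lean` placed by the injective
  embedding `addEmb`, with the window `b·2^{sh} mod 2^{Wd}`; `inv_step_lt`: the comparator placed by
  `ltEmb`, then a `CNOT` of its carry-out onto the flag);
* well-formed programs (`Instr.Shape`, `Instr.rdest`/`fdest`, `ProgWF`: shapes and no register or flag
  written twice), `run_regs_of_not_mem`/`run_flags_of_not_mem`, the invariant along a run (`inv_run`)
  and the **compiler correctness theorem** `SLP.clEval_compile`: started on an assignment holding the
  input on the input wires and clear on the layout, the compiled program ends with every register wire
  spelling the bits of the interpreted register value and every flag wire holding the interpreted flag.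

## References

* V. Vedral, A. Barenco, A. Ekert, *Quantum networks for elementary arithmetic operations*,
  Phys. Rev. A 54 (1996), §3.1, §3.3 [VedralBarencoEkert1996].
* M. A. Nielsen, I. L. Chuang, *Quantum Computation and Quantum Information*, CUP 2010, §3.2.5
  [NielsenChuang2010].
* S. Arora, B. Barak, *Computational Complexity: A Modern Approach*, CUP 2009, §10.3.7 Lemma 10.10
  [AroraBarakCC2009].
-/

namespace Literature.Computability.QuantumComplexity

namespace SLP

open Function

/-! ### One instruction preserves the invariant: the layer-shaped instructions -/

section StepsSimple

variable {Wd : ℕ} {L : Layout} {inp R F T : ℕ} (hV : L.Valid Wd R F) {t : ℕ} {st : State} {w : ℕ → Bool}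
  (hI : Inv L inp R F T (Wd := Wd) t st w)
include hV hI

/-- `setBit d i`. [folklore] -/
theorem inv_step_setBit {d i : ℕ} (hd : d < R) (hfresh : st.regs d = 0) :
    Inv L inp R F T (Wd := Wd) (t + 1) (step Wd inp st (.setBit d i)) (clEval (compileInstr L (Wd := Wd) t (.setBit d i)) w) := by
  have key : ∀ x, clEval (compileInstr L (Wd := Wd) t (.setBit d i)) w x = if i < Wd ∧ x = L.regW (Wd := Wd) d i then !w x else w x := by
    intro x
    simp only [compileInstr]
    by_cases hi : i < Wd
    · rw [if_pos hi, clEval_cons, clEval_nil, ClOp.eval_not]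
      by_cases hx : x = L.regW (Wd := Wd) d i
      · subst hx; simp [hi]
      · rw [update_of_ne hx, if_neg (fun h => hx h.2)]
    · rw [if_neg hi, clEval_nil, if_neg (fun h => hi h.1)]
  have hval : (step Wd inp st (.setBit d i)).regs = update st.regs d (if i < Wd then 2 ^ i else 0) := rfl
  refine ⟨fun ρ hρ j hj => ?_, fun φ hφ => ?_, fun t' ht' ht'T o ho => ?_, fun j hj => ?_, step_regs_lt Wd inp hI.bound _⟩
  · rw [key, hval, update_apply]
    by_cases hρd : ρ = d
    · subst hρd
      rw [hI.regs ρ hρ j hj, hfresh, Nat.zero_testBit, if_pos rfl]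
      by_cases hc : i < Wd ∧ L.regW (Wd := Wd) ρ j = L.regW (Wd := Wd) ρ i
      · rw [if_pos hc, if_pos hc.1, (Layout.regW_inj hj hc.1 hc.2).2, Nat.testBit_two_pow_self]; rfl
      · rw [if_neg hc]
        split_ifs with hi
        · rw [Nat.testBit_two_pow]
          have : i ≠ j := fun e => hc ⟨hi, by rw [e]⟩
          simp [this]
        · rw [Nat.zero_testBit]
    · rw [if_neg (fun h => hρd (Layout.regW_inj hj h.1 h.2).1), if_neg hρd, hI.regs ρ hρ j hj]
  · rw [key, if_neg (fun h => Layout.regW_ne_flagW hV hd h.1 h.2.symm), hI.flags φ hφ]; rfl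
  · rw [key, if_neg (fun h => Layout.regW_ne_scrW hV hd h.1 h.2.symm), hI.scr t' (by omega) ht'T o ho]
  · rw [key, if_neg (fun h => Layout.iw_ne_regW hV hj h.2), hI.input j hj]

/-- `copyIn d off len`. [folklore] -/
theorem inv_step_copyIn {d off len : ℕ} (hd : d < R) (hol : off + len ≤ L.kIn) (hlen : len ≤ Wd) (hfresh : st.regs d = 0) :
    Inv L inp R F T (Wd := Wd) (t + 1) (step Wd inp st (.copyIn d off len)) (clEval (compileInstr L (Wd := Wd) t (.copyIn d off len)) w) := by
  set ops := compileInstr L (Wd := Wd) t (.copyIn d off len) with hops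
  have hops' : ops = (List.range len).map fun j => ClOp.cnot (L.iw (off + j)) (L.regW (Wd := Wd) d j) := rfl
  have hdis : ∀ op ∈ ops, ∀ op' ∈ ops, op'.target ∉ op.controls := by
    intro op hop op' hop'
    rw [hops', List.mem_map] at hop hop'
    obtain ⟨j, hj, rfl⟩ := hop; obtain ⟨j', hj', rfl⟩ := hop'
    rw [List.mem_range] at hj hj'
    simp only [ClOp.controls, ClOp.target, List.mem_singleton]
    exact fun h => Layout.iw_ne_regW hV (by omega) h.symm
  have hnd : (ops.map ClOp.target).Nodup := by
    rw [hops', List.map_map]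
    refine (List.nodup_range).map_on fun j hj j' hj' h => ?_
    rw [List.mem_range] at hj hj'
    exact (Layout.regW_inj (Wd := Wd) (L := L) (by omega) (by omega) (by simpa [ClOp.target] using h)).2
  have key_t : ∀ j, j < len → clEval ops w (L.regW (Wd := Wd) d j) = (w (L.regW (Wd := Wd) d j) ^^ w (L.iw (off + j))) := by
    intro j hj
    have := clEval_apply_target_of_nodup ops hdis hnd w (op := ClOp.cnot (L.iw (off + j)) (L.regW (Wd := Wd) d j))
      (by rw [hops', List.mem_map]; exact ⟨j, List.mem_range.2 hj, rfl⟩)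
    simpa [ClOp.target, ClOp.guard] using this
  have key_o : ∀ x, (∀ j, j < len → x ≠ L.regW (Wd := Wd) d j) → clEval ops w x = w x := by
    intro x hx
    refine clEval_apply_of_forall_target_ne ops w fun op hop => ?_
    rw [hops', List.mem_map] at hop
    obtain ⟨j, hj, rfl⟩ := hop
    exact fun e => hx j (List.mem_range.1 hj) e.symm
  have hval : (step Wd inp st (.copyIn d off len)).regs = update st.regs d ((inp / 2 ^ off % 2 ^ len) % 2 ^ Wd) := rfl
  have hbits : ∀ j, j < Wd → ((inp / 2 ^ off % 2 ^ len) % 2 ^ Wd).testBit j = (decide (j < len) && inp.testBit (off + j)) := by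
    intro j hj
    rw [Nat.testBit_mod_two_pow, Nat.testBit_mod_two_pow, Nat.testBit_div_two_pow, Nat.add_comm]
    simp [hj]
  refine ⟨fun ρ hρ j hj => ?_, fun φ hφ => ?_, fun t' ht' ht'T o ho => ?_, fun j hj => ?_, step_regs_lt Wd inp hI.bound _⟩
  · rw [hval, update_apply]
    by_cases hρd : ρ = d
    · subst hρd
      rw [if_pos rfl, hbits j hj]
      by_cases hjk : j < len
      · rw [key_t j hjk, hI.regs ρ hρ j hj, hfresh, Nat.zero_testBit, hI.input (off + j) (by omega)]; simp [hjk]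
      · rw [key_o _ (fun j' hj' e => hjk ((Layout.regW_inj (Wd := Wd) hj (by omega) e).2 ▸ hj')), hI.regs ρ hρ j hj, hfresh, Nat.zero_testBit]
        simp [hjk]
    · rw [if_neg hρd, key_o _ (fun j' hj' e => hρd (Layout.regW_inj (Wd := Wd) hj (by omega) e).1), hI.regs ρ hρ j hj]
  · rw [key_o _ (fun j hj e => Layout.regW_ne_flagW hV hd (by omega) e.symm), hI.flags φ hφ]; rfl
  · rw [key_o _ (fun j hj e => Layout.regW_ne_scrW hV hd (by omega) e.symm), hI.scr t' (by omega) ht'T o ho]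
  · rw [key_o _ (fun j' hj' e => Layout.iw_ne_regW hV hj e), hI.input j hj]

/-- `andBit d x i y`. [cite: VedralBarencoEkert1996, §3.3 (partial products)] -/
theorem inv_step_andBit {d x i y : ℕ} (hd : d < R) (hx : x < R) (hy : y < R) (hdx : d ≠ x) (hdy : d ≠ y) (hi : i < Wd)
    (hfresh : st.regs d = 0) :
    Inv L inp R F T (Wd := Wd) (t + 1) (step Wd inp st (.andBit d x i y)) (clEval (compileInstr L (Wd := Wd) t (.andBit d x i y)) w) := by
  set ops := compileInstr L (Wd := Wd) t (.andBit d x i y) with hops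
  have hops' : ops = (List.range Wd).map fun j => ClOp.toffoli (L.regW (Wd := Wd) x i) (L.regW (Wd := Wd) y j) (L.regW (Wd := Wd) d j) := rfl
  have hdis : ∀ op ∈ ops, ∀ op' ∈ ops, op'.target ∉ op.controls := by
    intro op hop op' hop'
    rw [hops', List.mem_map] at hop hop'
    obtain ⟨j, hj, rfl⟩ := hop; obtain ⟨j', hj', rfl⟩ := hop'
    rw [List.mem_range] at hj hj'
    simp only [ClOp.controls, ClOp.target, List.mem_cons, List.not_mem_nil, or_false, not_or]
    exact ⟨fun h => hdx (Layout.regW_inj hj' hi h).1, fun h => hdy (Layout.regW_inj hj' hj h).1⟩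
  have hnd : (ops.map ClOp.target).Nodup := by
    rw [hops', List.map_map]
    refine (List.nodup_range).map_on fun j hj j' hj' h => ?_
    rw [List.mem_range] at hj hj'
    exact (Layout.regW_inj (L := L) hj hj' (by simpa [ClOp.target] using h)).2
  have key_t : ∀ j, j < Wd → clEval ops w (L.regW (Wd := Wd) d j) = (w (L.regW (Wd := Wd) d j) ^^ (w (L.regW (Wd := Wd) x i) && w (L.regW (Wd := Wd) y j))) := by
    intro j hj
    have := clEval_apply_target_of_nodup ops hdis hnd w (op := ClOp.toffoli (L.regW (Wd := Wd) x i) (L.regW (Wd := Wd) y j) (L.regW (Wd := Wd) d j))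
      (by rw [hops', List.mem_map]; exact ⟨j, List.mem_range.2 hj, rfl⟩)
    simpa [ClOp.target, ClOp.guard] using this
  have key_o : ∀ z, (∀ j, j < Wd → z ≠ L.regW (Wd := Wd) d j) → clEval ops w z = w z := by
    intro z hz
    refine clEval_apply_of_forall_target_ne ops w fun op hop => ?_
    rw [hops', List.mem_map] at hop
    obtain ⟨j, hj, rfl⟩ := hop
    exact fun e => hz j (List.mem_range.1 hj) e.symm
  have hval : (step Wd inp st (.andBit d x i y)).regs = update st.regs d (if (st.regs x).testBit i then st.regs y else 0) := rfl
  refine ⟨fun ρ hρ j hj => ?_, fun φ hφ => ?_, fun t' ht' ht'T o ho => ?_, fun j hj => ?_, step_regs_lt Wd inp hI.bound _⟩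
  · rw [hval, update_apply]
    by_cases hρd : ρ = d
    · subst hρd
      rw [if_pos rfl, key_t j hj, hI.regs ρ hρ j hj, hfresh, Nat.zero_testBit, hI.regs x hx i hi, hI.regs y hy j hj]
      cases (st.regs x).testBit i <;> simp
    · rw [if_neg hρd, key_o _ (fun j' hj' e => hρd (Layout.regW_inj hj hj' e).1), hI.regs ρ hρ j hj]
  · rw [key_o _ (fun j hj e => Layout.regW_ne_flagW hV hd hj e.symm), hI.flags φ hφ]; rfl
  · rw [key_o _ (fun j hj e => Layout.regW_ne_scrW hV hd hj e.symm), hI.scr t' (by omega) ht'T o ho]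
  · rw [key_o _ (fun j' hj' e => Layout.iw_ne_regW hV hj e), hI.input j hj]

/-- `fand f g h`. [folklore] -/
theorem inv_step_fand {f g h : ℕ} (hf : f < F) (hg : g < F) (hh : h < F)
    (hfresh : st.flags f = false) :
    Inv L inp R F T (Wd := Wd) (t + 1) (step Wd inp st (.fand f g h)) (clEval (compileInstr L (Wd := Wd) t (.fand f g h)) w) := by
  have key : ∀ x, clEval (compileInstr L (Wd := Wd) t (.fand f g h)) w x =
      if x = L.flagW f then (w x ^^ (w (L.flagW g) && w (L.flagW h))) else w x := by
    intro x
    simp only [compileInstr, clEval_cons, clEval_nil, ClOp.eval_toffoli]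
    by_cases hx : x = L.flagW f
    · subst hx; rw [update_self, if_pos rfl]
    · rw [update_of_ne hx, if_neg hx]
  have hval : (step Wd inp st (.fand f g h)).flags = update st.flags f (st.flags g && st.flags h) := rfl
  have hregs : (step Wd inp st (.fand f g h)).regs = st.regs := rfl
  refine ⟨fun ρ hρ j hj => ?_, fun φ hφ => ?_, fun t' ht' ht'T o ho => ?_, fun j hj => ?_, step_regs_lt Wd inp hI.bound _⟩
  · rw [key, if_neg (Layout.regW_ne_flagW hV hρ hj), hregs, hI.regs ρ hρ j hj]
  · rw [key, hval, update_apply]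
    by_cases hφf : φ = f
    · subst hφf; rw [if_pos rfl, if_pos rfl, hI.flags φ hφ, hfresh, hI.flags g hg, hI.flags h hh]; simp
    · rw [if_neg (fun e => hφf (flagW_injective e)), if_neg hφf, hI.flags φ hφ]
  · rw [key, if_neg (fun e => Layout.flagW_ne_scrW hV hf e.symm), hI.scr t' (by omega) ht'T o ho]
  · rw [key, if_neg (Layout.iw_ne_flagW hV hj), hI.input j hj]

/-- `fnot f g`. [folklore] -/
theorem inv_step_fnot {f g : ℕ} (hf : f < F) (hg : g < F) (hfg : f ≠ g) (hfresh : st.flags f = false) :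
    Inv L inp R F T (Wd := Wd) (t + 1) (step Wd inp st (.fnot f g)) (clEval (compileInstr L (Wd := Wd) t (.fnot f g)) w) := by
  have hne : L.flagW f ≠ L.flagW g := fun e => hfg (flagW_injective e)
  have key : ∀ x, clEval (compileInstr L (Wd := Wd) t (.fnot f g)) w x = if x = L.flagW f then !(w x ^^ w (L.flagW g)) else w x := by
    intro x
    simp only [compileInstr, clEval_cons, clEval_nil, ClOp.eval_cnot, ClOp.eval_not]
    by_cases hx : x = L.flagW f
    · subst hx; rw [update_self, update_self, if_pos rfl]
    · rw [update_of_ne hx, update_of_ne hx, if_neg hx]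
  have hval : (step Wd inp st (.fnot f g)).flags = update st.flags f (!st.flags g) := rfl
  have hregs : (step Wd inp st (.fnot f g)).regs = st.regs := rfl
  refine ⟨fun ρ hρ j hj => ?_, fun φ hφ => ?_, fun t' ht' ht'T o ho => ?_, fun j hj => ?_, step_regs_lt Wd inp hI.bound _⟩
  · rw [key, if_neg (Layout.regW_ne_flagW hV hρ hj), hregs, hI.regs ρ hρ j hj]
  · rw [key, hval, update_apply]
    by_cases hφf : φ = f
    · subst hφf; rw [if_pos rfl, if_pos rfl, hI.flags φ hφ, hfresh, hI.flags g hg]; simp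
    · rw [if_neg (fun e => hφf (flagW_injective e)), if_neg hφf, hI.flags φ hφ]
  · rw [key, if_neg (fun e => Layout.flagW_ne_scrW hV hf e.symm), hI.scr t' (by omega) ht'T o ho]
  · rw [key, if_neg (Layout.iw_ne_flagW hV hj), hI.input j hj]

/-- `forr f g h` (`¬(¬g ∧ ¬h)`, with `g`, `h` restored). [folklore] -/
theorem inv_step_forr {f g h : ℕ} (hf : f < F) (hg : g < F) (hh : h < F) (hfg : f ≠ g) (hfh : f ≠ h) (hgh : g ≠ h)
    (hfresh : st.flags f = false) :
    Inv L inp R F T (Wd := Wd) (t + 1) (step Wd inp st (.forr f g h)) (clEval (compileInstr L (Wd := Wd) t (.forr f g h)) w) := by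
  have nfg : L.flagW f ≠ L.flagW g := fun e => hfg (flagW_injective e)
  have nfh : L.flagW f ≠ L.flagW h := fun e => hfh (flagW_injective e)
  have ngh : L.flagW g ≠ L.flagW h := fun e => hgh (flagW_injective e)
  have key : ∀ x, clEval (compileInstr L (Wd := Wd) t (.forr f g h)) w x =
      if x = L.flagW f then !(w x ^^ (!w (L.flagW g) && !w (L.flagW h))) else w x := by
    intro x
    simp only [compileInstr, clEval_cons, clEval_nil, ClOp.eval_not, ClOp.eval_toffoli]
    by_cases hxf : x = L.flagW f
    · subst hxf
      simp [nfg, nfh, ngh, nfg.symm, nfh.symm, ngh.symm]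
    · by_cases hxg : x = L.flagW g
      · subst hxg; simp [nfg, nfh, ngh, nfg.symm, nfh.symm, ngh.symm]
      · by_cases hxh : x = L.flagW h
        · subst hxh; simp [nfg, nfh, ngh, nfg.symm, nfh.symm, ngh.symm]
        · simp [update_apply, hxf, hxg, hxh]
  have hval : (step Wd inp st (.forr f g h)).flags = update st.flags f (st.flags g || st.flags h) := rfl
  have hregs : (step Wd inp st (.forr f g h)).regs = st.regs := rfl
  refine ⟨fun ρ hρ j hj => ?_, fun φ hφ => ?_, fun t' ht' ht'T o ho => ?_, fun j hj => ?_, step_regs_lt Wd inp hI.bound _⟩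
  · rw [key, if_neg (Layout.regW_ne_flagW hV hρ hj), hregs, hI.regs ρ hρ j hj]
  · rw [key, hval, update_apply]
    by_cases hφf : φ = f
    · subst hφf
      rw [if_pos rfl, if_pos rfl, hI.flags φ hφ, hfresh, hI.flags g hg, hI.flags h hh]
      cases st.flags g <;> cases st.flags h <;> rfl
    · rw [if_neg (fun e => hφf (flagW_injective e)), if_neg hφf, hI.flags φ hφ]
  · rw [key, if_neg (fun e => Layout.flagW_ne_scrW hV hf e.symm), hI.scr t' (by omega) ht'T o ho]
  · rw [key, if_neg (Layout.iw_ne_flagW hV hj), hI.input j hj]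

end StepsSimple

/-! ### One instruction preserves the invariant: the adder and the comparator -/

section StepsGadget

variable {Wd : ℕ} {L : Layout} {inp R F T : ℕ} (hV : L.Valid Wd R F) {t : ℕ} (ht : t < T) {st : State} {w : ℕ → Bool}
  (hI : Inv L inp R F T (Wd := Wd) t st w)

/-- From `S + c·2^W = N` with `S < 2^W` and a bit `c`: `S = N mod 2^W`. [folklore] -/
theorem eq_mod_of_add_bit_mul {S N W : ℕ} {c : Bool} (h : S + c.toNat * 2 ^ W = N) (hS : S < 2 ^ W) : S = N % 2 ^ W := by
  cases c
  · simp at h; rw [← h, Nat.mod_eq_of_lt hS]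
  · simp at h; rw [← h, Nat.add_mod_right, Nat.mod_eq_of_lt hS]

/-- The bits of a shifted value truncated to `Wd` bits. [folklore] -/
theorem testBit_mul_two_pow_mod (B sh j : ℕ) (hj : j < Wd) :
    ((B * 2 ^ sh) % 2 ^ Wd).testBit j = (decide (sh ≤ j) && B.testBit (j - sh)) := by
  rw [Nat.testBit_mod_two_pow, Nat.testBit_mul_two_pow]; simp [hj]

/-- **The adder embedding is injective** (distinct registers, valid layout). [folklore] -/
theorem Layout.addEmb_injective (hV : L.Valid Wd R F) {t d a b sh : ℕ} (hd : d < R) (ha : a < R) (hb : b < R) (hda : d ≠ a)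
    (hdb : d ≠ b) (hab : a ≠ b) : Function.Injective (L.addEmb (Wd := Wd) t d a b sh) := by
  set e := L.addEmb (Wd := Wd) t d a b sh with he
  have hS : ∀ j, j ≤ 3 * Wd → j < scrSize Wd := fun j hj => by unfold scrSize; omega
  have ea : ∀ j : Fin Wd, e (AddW.a j) = L.regW (Wd := Wd) a j := fun j => rfl
  have eb : ∀ j : Fin Wd, e (AddW.b j) = if sh ≤ (j : ℕ) then L.regW (Wd := Wd) b (j - sh) else L.scrW (Wd := Wd) t (Wd + 1 + j) :=
    fun j => by simp only [he, Layout.addEmb, Layout.zerW_eq]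
  have es : ∀ j : Fin Wd, e (AddW.s j) = L.regW (Wd := Wd) d j := fun j => rfl
  have ec : ∀ j : Fin (Wd + 1), e (AddW.c j) = L.scrW (Wd := Wd) t j := fun j => rfl
  intro x y hxy
  cases x with
  | a j =>
    cases y with
    | a j' => rw [ea, ea] at hxy; exact congrArg _ (Fin.ext (Layout.regW_inj j.2 j'.2 hxy).2)
    | b j' =>
      rw [ea, eb] at hxy; split_ifs at hxy with h
      · exact absurd (Layout.regW_inj j.2 (by omega) hxy).1 hab
      · exact absurd hxy (Layout.regW_ne_scrW hV ha j.2)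
    | s j' => rw [ea, es] at hxy; exact absurd (Layout.regW_inj j.2 j'.2 hxy).1 (Ne.symm hda)
    | c j' => rw [ea, ec] at hxy; exact absurd hxy (Layout.regW_ne_scrW hV ha j.2)
  | b j =>
    cases y with
    | a j' =>
      rw [eb, ea] at hxy; split_ifs at hxy with h
      · exact absurd (Layout.regW_inj (by omega) j'.2 hxy).1 (Ne.symm hab)
      · exact absurd hxy.symm (Layout.regW_ne_scrW hV ha j'.2)
    | b j' =>
      rw [eb, eb] at hxy; split_ifs at hxy with h h'
      · exact congrArg _ (Fin.ext (by have := (Layout.regW_inj (by omega) (by omega) hxy).2; omega))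
      · exact absurd hxy (Layout.regW_ne_scrW hV hb (by omega))
      · exact absurd hxy.symm (Layout.regW_ne_scrW hV hb (by omega))
      · exact congrArg _ (Fin.ext (by have := (Layout.scrW_inj (hS _ (by omega)) (hS _ (by omega)) hxy).2; omega))
    | s j' =>
      rw [eb, es] at hxy; split_ifs at hxy with h
      · exact absurd (Layout.regW_inj (by omega) j'.2 hxy).1 (Ne.symm hdb)
      · exact absurd hxy.symm (Layout.regW_ne_scrW hV hd j'.2)
    | c j' =>
      rw [eb, ec] at hxy; split_ifs at hxy with h
      · exact absurd hxy (Layout.regW_ne_scrW hV hb (by omega))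
      · have := (Layout.scrW_inj (hS _ (by omega)) (hS _ (by omega)) hxy).2; omega
  | s j =>
    cases y with
    | a j' => rw [es, ea] at hxy; exact absurd (Layout.regW_inj j.2 j'.2 hxy).1 hda
    | b j' =>
      rw [es, eb] at hxy; split_ifs at hxy with h
      · exact absurd (Layout.regW_inj j.2 (by omega) hxy).1 hdb
      · exact absurd hxy (Layout.regW_ne_scrW hV hd j.2)
    | s j' => rw [es, es] at hxy; exact congrArg _ (Fin.ext (Layout.regW_inj j.2 j'.2 hxy).2)
    | c j' => rw [es, ec] at hxy; exact absurd hxy (Layout.regW_ne_scrW hV hd j.2)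
  | c j =>
    cases y with
    | a j' => rw [ec, ea] at hxy; exact absurd hxy.symm (Layout.regW_ne_scrW hV ha j'.2)
    | b j' =>
      rw [ec, eb] at hxy; split_ifs at hxy with h
      · exact absurd hxy.symm (Layout.regW_ne_scrW hV hb (by omega))
      · have := (Layout.scrW_inj (hS _ (by omega)) (hS _ (by omega)) hxy).2; omega
    | s j' => rw [ec, es] at hxy; exact absurd hxy.symm (Layout.regW_ne_scrW hV hd j'.2)
    | c j' => rw [ec, ec] at hxy; exact congrArg _ (Fin.ext (Layout.scrW_inj (hS _ (by omega)) (hS _ (by omega)) hxy).2)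


/-- **The comparator embedding is injective** (distinct registers, valid layout). [folklore] -/
theorem Layout.ltEmb_injective (hV : L.Valid Wd R F) {t a b : ℕ} (ha : a < R) (hb : b < R) (hab : a ≠ b) :
    Function.Injective (L.ltEmb (Wd := Wd) t a b) := by
  set e := L.ltEmb (Wd := Wd) t a b with he
  have hS : ∀ j, j ≤ 3 * Wd → j < scrSize Wd := fun j hj => by unfold scrSize; omega
  have ea : ∀ j : Fin Wd, e (AddW.a j) = L.regW (Wd := Wd) b j := fun j => rfl
  have eb : ∀ j : Fin Wd, e (AddW.b j) = L.regW (Wd := Wd) a j := fun j => rfl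
  have es : ∀ j : Fin Wd, e (AddW.s j) = L.scrW (Wd := Wd) t (2 * Wd + 1 + j) := fun j => by simp only [he, Layout.ltEmb, Layout.sumW_eq]
  have ec : ∀ j : Fin (Wd + 1), e (AddW.c j) = L.scrW (Wd := Wd) t j := fun j => rfl
  intro x y hxy
  cases x with
  | a j =>
    cases y with
    | a j' => rw [ea, ea] at hxy; exact congrArg _ (Fin.ext (Layout.regW_inj j.2 j'.2 hxy).2)
    | b j' => rw [ea, eb] at hxy; exact absurd (Layout.regW_inj j.2 j'.2 hxy).1 (Ne.symm hab)
    | s j' => rw [ea, es] at hxy; exact absurd hxy (Layout.regW_ne_scrW hV hb j.2)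
    | c j' => rw [ea, ec] at hxy; exact absurd hxy (Layout.regW_ne_scrW hV hb j.2)
  | b j =>
    cases y with
    | a j' => rw [eb, ea] at hxy; exact absurd (Layout.regW_inj j.2 j'.2 hxy).1 hab
    | b j' => rw [eb, eb] at hxy; exact congrArg _ (Fin.ext (Layout.regW_inj j.2 j'.2 hxy).2)
    | s j' => rw [eb, es] at hxy; exact absurd hxy (Layout.regW_ne_scrW hV ha j.2)
    | c j' => rw [eb, ec] at hxy; exact absurd hxy (Layout.regW_ne_scrW hV ha j.2)
  | s j =>
    cases y with
    | a j' => rw [es, ea] at hxy; exact absurd hxy.symm (Layout.regW_ne_scrW hV hb j'.2)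
    | b j' => rw [es, eb] at hxy; exact absurd hxy.symm (Layout.regW_ne_scrW hV ha j'.2)
    | s j' => rw [es, es] at hxy; exact congrArg _ (Fin.ext (by have := (Layout.scrW_inj (hS _ (by omega)) (hS _ (by omega)) hxy).2; omega))
    | c j' => rw [es, ec] at hxy; have := (Layout.scrW_inj (hS _ (by omega)) (hS _ (by have := j'.2; omega)) hxy).2; omega
  | c j =>
    cases y with
    | a j' => rw [ec, ea] at hxy; exact absurd hxy.symm (Layout.regW_ne_scrW hV hb j'.2)
    | b j' => rw [ec, eb] at hxy; exact absurd hxy.symm (Layout.regW_ne_scrW hV ha j'.2)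
    | s j' => rw [ec, es] at hxy; have := (Layout.scrW_inj (hS _ (by have := j.2; omega)) (hS _ (by omega)) hxy).2; omega
    | c j' => rw [ec, ec] at hxy; exact congrArg _ (Fin.ext (Layout.scrW_inj (hS _ (by have := j.2; omega)) (hS _ (by have := j'.2; omega)) hxy).2)


include hV ht hI

/-- **`add d a b sh`**: the ripple-carry adder placed by `addEmb`. [cite: VedralBarencoEkert1996, §3.1] -/
theorem inv_step_add {d a b sh : ℕ} (hd : d < R) (ha : a < R) (hb : b < R) (hda : d ≠ a) (hdb : d ≠ b) (hab : a ≠ b)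
    (hfresh : st.regs d = 0) :
    Inv L inp R F T (Wd := Wd) (t + 1) (step Wd inp st (.add d a b sh)) (clEval (compileInstr L (Wd := Wd) t (.add d a b sh)) w) := by
  set e := L.addEmb (Wd := Wd) t d a b sh with he
  have hS : ∀ j, j ≤ 3 * Wd → j < scrSize Wd := fun j hj => by unfold scrSize; omega
  -- values of `e`
  have ea : ∀ j : Fin Wd, e (AddW.a j) = L.regW (Wd := Wd) a j := fun j => rfl
  have eb : ∀ j : Fin Wd, e (AddW.b j) = if sh ≤ (j : ℕ) then L.regW (Wd := Wd) b (j - sh) else L.scrW (Wd := Wd) t (Wd + 1 + j) :=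
    fun j => by simp only [he, Layout.addEmb, Layout.zerW_eq]
  have es : ∀ j : Fin Wd, e (AddW.s j) = L.regW (Wd := Wd) d j := fun j => rfl
  have ec : ∀ j : Fin (Wd + 1), e (AddW.c j) = L.scrW (Wd := Wd) t j := fun j => rfl
  have hinj : Function.Injective e := Layout.addEmb_injective hV hd ha hb hda hdb hab
  -- the pulled-back assignment and its hypotheses
  set w₀ : AddW Wd → Bool := w ∘ e with hw₀
  have hs₀ : ∀ j, w₀ (AddW.s j) = false := fun j => by
    show w (e _) = false; rw [es, hI.regs d hd j j.2, hfresh, Nat.zero_testBit]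
  have hc₀ : ∀ j : Fin (Wd + 1), w₀ (AddW.c j) = false := fun j => by
    show w (e _) = false; rw [ec]; exact hI.scr t le_rfl ht j (hS _ (by omega))
  have hops : compileInstr L (Wd := Wd) t (.add d a b sh) = (addOps Wd).map (ClOp.map e) := rfl
  -- the values
  have hA : regVal AddW.a w₀ = st.regs a := by
    rw [show regVal AddW.a w₀ = regVal (fun j : Fin Wd => L.regW (Wd := Wd) a j) w from rfl]; exact hI.regVal_eq ha
  have hB : regVal AddW.b w₀ = (st.regs b * 2 ^ sh) % 2 ^ Wd := by
    refine regVal_eq_of_testBit _ _ (Nat.mod_lt _ (Nat.two_pow_pos Wd)) fun j => ?_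
    show w (e _) = _
    rw [eb, testBit_mul_two_pow_mod (Wd := Wd) (st.regs b) sh j j.2]
    split_ifs with h
    · rw [hI.regs b hb _ (by omega)]; simp [h]
    · rw [hI.scr t le_rfl ht _ (hS _ (by omega))]; simp [h]
  have hsum := regVal_addOps w₀ hs₀ (fun j _ => hc₀ j)
  rw [hc₀ 0, Bool.toNat_false, add_zero, hA, hB] at hsum
  have hval : regVal AddW.s (clEval (addOps Wd) w₀) = (st.regs a + st.regs b * 2 ^ sh) % 2 ^ Wd := by
    rw [eq_mod_of_add_bit_mul hsum (regVal_lt _ _), Nat.add_mod, Nat.mod_mod, ← Nat.add_mod]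
  -- off the range of `e` nothing changes
  have key_o : ∀ z, (∀ x, e x ≠ z) → clEval ((addOps Wd).map (ClOp.map e)) w z = w z :=
    fun z hz => clEval_map_apply_of_not_mem_range e _ w (by rintro ⟨x, hx⟩; exact hz x hx)
  have key_i : ∀ x, clEval ((addOps Wd).map (ClOp.map e)) w (e x) = clEval (addOps Wd) w₀ x :=
    fun x => clEval_map_apply hinj _ w x
  have hvalr : (step Wd inp st (.add d a b sh)).regs = update st.regs d ((st.regs a + st.regs b * 2 ^ sh) % 2 ^ Wd) := rfl
  rw [hops]
  refine ⟨fun ρ hρ j hj => ?_, fun φ hφ => ?_, fun t' ht' ht'T o ho => ?_, fun j hj => ?_, step_regs_lt Wd inp hI.bound _⟩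
  · rw [hvalr, update_apply]
    by_cases hρd : ρ = d
    · subst hρd
      rw [if_pos rfl, ← es ⟨j, hj⟩, key_i, ← testBit_regVal AddW.s (clEval (addOps Wd) w₀) ⟨j, hj⟩, hval]
    · rw [if_neg hρd]
      by_cases hρa : ρ = a
      · subst hρa; rw [← ea ⟨j, hj⟩, key_i, clEval_addOps w₀ hs₀ (fun j _ => hc₀ j)]; exact hI.regs ρ hρ j hj
      · by_cases hρb : ρ = b ∧ j + sh < Wd
        · obtain ⟨rfl, hjs⟩ := hρb
          have : e (AddW.b ⟨j + sh, hjs⟩) = L.regW (Wd := Wd) ρ j := by rw [eb]; simp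
          rw [← this, key_i, clEval_addOps w₀ hs₀ (fun j _ => hc₀ j)]
          show w (e _) = _; rw [this]; exact hI.regs ρ hρ j hj
        · rw [key_o, hI.regs ρ hρ j hj]
          intro x hx
          cases x with
          | a j' => rw [ea] at hx; exact hρa (Layout.regW_inj hj j'.2 hx.symm).1
          | b j' =>
            rw [eb] at hx; split_ifs at hx with h
            · have h1 := Layout.regW_inj (L := L) hj (by omega) hx.symm
              exact hρb ⟨h1.1, by have := j'.2; omega⟩
            · exact Layout.regW_ne_scrW hV hρ hj hx.symm
          | s j' => rw [es] at hx; exact hρd (Layout.regW_inj hj j'.2 hx.symm).1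
          | c j' => rw [ec] at hx; exact Layout.regW_ne_scrW hV hρ hj hx.symm
  · rw [key_o, hI.flags φ hφ]
    · rfl
    · intro x hx
      cases x with
      | a j' => rw [ea] at hx; exact Layout.regW_ne_flagW hV ha j'.2 hx
      | b j' =>
        rw [eb] at hx; split_ifs at hx with h
        · exact Layout.regW_ne_flagW hV hb (by omega) hx
        · exact Layout.flagW_ne_scrW hV hφ hx.symm
      | s j' => rw [es] at hx; exact Layout.regW_ne_flagW hV hd j'.2 hx
      | c j' => rw [ec] at hx; exact Layout.flagW_ne_scrW hV hφ hx.symm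
  · rw [key_o, hI.scr t' (by omega) ht'T o ho]
    intro x hx
    have ht' : t ≠ t' := by omega
    cases x with
    | a j' => rw [ea] at hx; exact Layout.regW_ne_scrW hV ha j'.2 hx
    | b j' =>
      rw [eb] at hx; split_ifs at hx with h
      · exact Layout.regW_ne_scrW hV hb (by omega) hx
      · exact ht' (Layout.scrW_inj (hS _ (by omega)) ho hx).1
    | s j' => rw [es] at hx; exact Layout.regW_ne_scrW hV hd j'.2 hx
    | c j' => rw [ec] at hx; exact ht' (Layout.scrW_inj (hS _ (by have := j'.2; omega)) ho hx).1
  · rw [key_o, hI.input j hj]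
    intro x hx
    cases x with
    | a j' => rw [ea] at hx; exact Layout.iw_ne_regW hV hj hx.symm
    | b j' =>
      rw [eb] at hx; split_ifs at hx with h
      · exact Layout.iw_ne_regW hV hj hx.symm
      · exact Layout.iw_ne_scrW hV hj hx.symm
    | s j' => rw [es] at hx; exact Layout.iw_ne_regW hV hj hx.symm
    | c j' => rw [ec] at hx; exact Layout.iw_ne_scrW hV hj hx.symm

/-- **`lt f a b`**: the comparator placed by `ltEmb`, then a `CNOT` of its carry-out onto the flag.
[folklore] -/
theorem inv_step_lt {f a b : ℕ} (hf : f < F) (ha : a < R) (hb : b < R) (hab : a ≠ b) (hfresh : st.flags f = false) :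
    Inv L inp R F T (Wd := Wd) (t + 1) (step Wd inp st (.lt f a b)) (clEval (compileInstr L (Wd := Wd) t (.lt f a b)) w) := by
  set e := L.ltEmb (Wd := Wd) t a b with he
  have hS : ∀ j, j ≤ 3 * Wd → j < scrSize Wd := fun j hj => by unfold scrSize; omega
  have ea : ∀ j : Fin Wd, e (AddW.a j) = L.regW (Wd := Wd) b j := fun j => rfl
  have eb : ∀ j : Fin Wd, e (AddW.b j) = L.regW (Wd := Wd) a j := fun j => rfl
  have es : ∀ j : Fin Wd, e (AddW.s j) = L.scrW (Wd := Wd) t (2 * Wd + 1 + j) := fun j => by simp only [he, Layout.ltEmb, Layout.sumW_eq]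
  have ec : ∀ j : Fin (Wd + 1), e (AddW.c j) = L.scrW (Wd := Wd) t j := fun j => rfl
  have hinj : Function.Injective e := Layout.ltEmb_injective hV ha hb hab
  set w₀ : AddW Wd → Bool := w ∘ e with hw₀
  have hs₀ : ∀ j, w₀ (AddW.s j) = false := fun j => by
    show w (e _) = false; rw [es]; exact hI.scr t le_rfl ht _ (hS _ (by omega))
  have hc₀ : ∀ j : Fin (Wd + 1), w₀ (AddW.c j) = false := fun j => by
    show w (e _) = false; rw [ec]; exact hI.scr t le_rfl ht j (hS _ (by omega))
  have hA : regVal AddW.a w₀ = st.regs b := by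
    rw [show regVal AddW.a w₀ = regVal (fun j : Fin Wd => L.regW (Wd := Wd) b j) w from rfl]; exact hI.regVal_eq hb
  have hB : regVal AddW.b w₀ = st.regs a := by
    rw [show regVal AddW.b w₀ = regVal (fun j : Fin Wd => L.regW (Wd := Wd) a j) w from rfl]; exact hI.regVal_eq ha
  obtain ⟨hcmp, hresA, hresB⟩ := clEval_ltOps_apply w₀ hs₀ hc₀
  rw [hA, hB] at hcmp
  set ops₁ := (ltOps Wd).map (ClOp.map e) with hops₁
  have hops : compileInstr L (Wd := Wd) t (.lt f a b) = ops₁ ++ [ClOp.cnot (L.scrW (Wd := Wd) t Wd) (L.flagW f)] := rfl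
  have key_o : ∀ z, (∀ x, e x ≠ z) → clEval ops₁ w z = w z :=
    fun z hz => clEval_map_apply_of_not_mem_range e _ w (by rintro ⟨x, hx⟩; exact hz x hx)
  have key_i : ∀ x, clEval ops₁ w (e x) = clEval (ltOps Wd) w₀ x := fun x => clEval_map_apply hinj _ w x
  -- the whole instruction
  have hall : ∀ z, clEval (compileInstr L (Wd := Wd) t (.lt f a b)) w z =
      if z = L.flagW f then (clEval ops₁ w z ^^ clEval ops₁ w (L.scrW (Wd := Wd) t Wd)) else clEval ops₁ w z := by
    intro z
    rw [hops, clEval_append, clEval_cons, clEval_nil, ClOp.eval_cnot]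
    by_cases hz : z = L.flagW f
    · subst hz; rw [update_self, if_pos rfl]
    · rw [update_of_ne hz, if_neg hz]
  have hcarry : clEval ops₁ w (L.scrW (Wd := Wd) t Wd) = decide (st.regs a < st.regs b) := by
    rw [← hcmp, show L.scrW (Wd := Wd) t Wd = e (AddW.c (Fin.last Wd)) by rw [ec]; rfl, key_i]
  have hvalf : (step Wd inp st (.lt f a b)).flags = update st.flags f (decide (st.regs a < st.regs b)) := rfl
  have hregs : (step Wd inp st (.lt f a b)).regs = st.regs := rfl
  have hne_flag : ∀ φ, φ < F → ∀ x, e x ≠ L.flagW φ := by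
    intro φ hφ x hx
    cases x with
    | a j' => rw [ea] at hx; exact Layout.regW_ne_flagW hV hb j'.2 hx
    | b j' => rw [eb] at hx; exact Layout.regW_ne_flagW hV ha j'.2 hx
    | s j' => rw [es] at hx; exact Layout.flagW_ne_scrW hV hφ hx.symm
    | c j' => rw [ec] at hx; exact Layout.flagW_ne_scrW hV hφ hx.symm
  refine ⟨fun ρ hρ j hj => ?_, fun φ hφ => ?_, fun t' ht' ht'T o ho => ?_, fun j hj => ?_, step_regs_lt Wd inp hI.bound _⟩
  · rw [hall, if_neg (Layout.regW_ne_flagW hV hρ hj), hregs]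
    by_cases hρa : ρ = a
    · subst hρa; rw [← eb ⟨j, hj⟩, key_i, hresB]; exact hI.regs ρ hρ j hj
    · by_cases hρb : ρ = b
      · subst hρb; rw [← ea ⟨j, hj⟩, key_i, hresA]; exact hI.regs ρ hρ j hj
      · rw [key_o, hI.regs ρ hρ j hj]
        intro x hx
        cases x with
        | a j' => rw [ea] at hx; exact hρb (Layout.regW_inj hj j'.2 hx.symm).1
        | b j' => rw [eb] at hx; exact hρa (Layout.regW_inj hj j'.2 hx.symm).1
        | s j' => rw [es] at hx; exact Layout.regW_ne_scrW hV hρ hj hx.symm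
        | c j' => rw [ec] at hx; exact Layout.regW_ne_scrW hV hρ hj hx.symm
  · rw [hall, hvalf, update_apply]
    by_cases hφf : φ = f
    · subst hφf; rw [if_pos rfl, if_pos rfl, hcarry, key_o _ (hne_flag φ hφ), hI.flags φ hφ, hfresh]; simp
    · rw [if_neg (fun e => hφf (flagW_injective e)), if_neg hφf, key_o _ (hne_flag φ hφ), hI.flags φ hφ]
  · rw [hall, if_neg (fun e => Layout.flagW_ne_scrW hV hf e.symm), key_o, hI.scr t' (by omega) ht'T o ho]
    intro x hx
    have ht' : t ≠ t' := by omega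
    cases x with
    | a j' => rw [ea] at hx; exact Layout.regW_ne_scrW hV hb j'.2 hx
    | b j' => rw [eb] at hx; exact Layout.regW_ne_scrW hV ha j'.2 hx
    | s j' => rw [es] at hx; exact ht' (Layout.scrW_inj (hS _ (by omega)) ho hx).1
    | c j' => rw [ec] at hx; exact ht' (Layout.scrW_inj (hS _ (by have := j'.2; omega)) ho hx).1
  · rw [hall, if_neg (Layout.iw_ne_flagW hV hj), key_o, hI.input j hj]
    intro x hx
    cases x with
    | a j' => rw [ea] at hx; exact Layout.iw_ne_regW hV hj hx.symm
    | b j' => rw [eb] at hx; exact Layout.iw_ne_regW hV hj hx.symm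
    | s j' => rw [es] at hx; exact Layout.iw_ne_scrW hV hj hx.symm
    | c j' => rw [ec] at hx; exact Layout.iw_ne_scrW hV hj hx.symm

end StepsGadget

/-! ### Well-formed programs and the compiler correctness theorem -/

section Main

/-- **The shape of an instruction** relative to the width `Wd`, the input width `kIn` and the bounds
`R` (registers), `F` (flags): indices in range and the wires of each emitted gate distinct. [folklore] -/
def Instr.Shape (Wd kIn R F : ℕ) : Instr → Prop
  | .copyIn d off len => d < R ∧ off + len ≤ kIn ∧ len ≤ Wd
  | .setBit d _ => d < R
  | .add d a b _ => d < R ∧ a < R ∧ b < R ∧ d ≠ a ∧ d ≠ b ∧ a ≠ b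
  | .andBit d x i y => d < R ∧ x < R ∧ y < R ∧ d ≠ x ∧ d ≠ y ∧ x ≠ y ∧ i < Wd
  | .lt f a b => f < F ∧ a < R ∧ b < R ∧ a ≠ b
  | .fnot f g => f < F ∧ g < F ∧ f ≠ g
  | .fand f g h => f < F ∧ g < F ∧ h < F ∧ f ≠ g ∧ f ≠ h ∧ g ≠ h
  | .forr f g h => f < F ∧ g < F ∧ h < F ∧ f ≠ g ∧ f ≠ h ∧ g ≠ h

/-- The register written by an instruction, if any. [folklore] -/
def Instr.rdest : Instr → Option ℕ
  | .copyIn d _ _ => some d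
  | .setBit d _ => some d
  | .add d _ _ _ => some d
  | .andBit d _ _ _ => some d
  | _ => none

/-- The flag written by an instruction, if any. [folklore] -/
def Instr.fdest : Instr → Option ℕ
  | .lt f _ _ => some f
  | .fnot f _ => some f
  | .fand f _ _ => some f
  | .forr f _ _ => some f
  | _ => none

/-- **Well-formed programs**: every instruction has the right shape, and no register or flag is
written twice (so every destination is fresh, i.e. still zero, when written). [folklore] -/
structure ProgWF (Wd kIn R F : ℕ) (p : List Instr) : Prop where
  /-- shapes -/
  shape : ∀ ins ∈ p, ins.Shape Wd kIn R F
  /-- registers are written once -/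
  rdest_nodup : (p.filterMap Instr.rdest).Nodup
  /-- flags are written once -/
  fdest_nodup : (p.filterMap Instr.fdest).Nodup

variable (Wd : ℕ) (inp : ℕ)

/-- A register that is not written keeps its value. [folklore] -/
theorem run_regs_of_not_mem {d : ℕ} : ∀ (p : List Instr) (st : State), d ∉ p.filterMap Instr.rdest → (run Wd inp st p).regs d = st.regs d
  | [], _, _ => rfl
  | ins :: p, st, hd => by
    rw [List.filterMap_cons] at hd
    have hd' : d ∉ p.filterMap Instr.rdest := fun h => hd (by cases h' : ins.rdest <;> simp [h])
    rw [run, run_regs_of_not_mem p _ hd']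
    cases ins with
    | copyIn d' o l => exact update_of_ne (fun e => hd (by subst e; simp [Instr.rdest])) _ _
    | setBit d' i => exact update_of_ne (fun e => hd (by subst e; simp [Instr.rdest])) _ _
    | add d' a b sh => exact update_of_ne (fun e => hd (by subst e; simp [Instr.rdest])) _ _
    | andBit d' x i y => exact update_of_ne (fun e => hd (by subst e; simp [Instr.rdest])) _ _
    | lt f a b => rfl
    | fnot f g => rfl
    | fand f g h => rfl
    | forr f g h => rfl

/-- A flag that is not written keeps its value. [folklore] -/
theorem run_flags_of_not_mem {f : ℕ} : ∀ (p : List Instr) (st : State), f ∉ p.filterMap Instr.fdest → (run Wd inp st p).flags f = st.flags f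
  | [], _, _ => rfl
  | ins :: p, st, hf => by
    rw [List.filterMap_cons] at hf
    have hf' : f ∉ p.filterMap Instr.fdest := fun h => hf (by cases h' : ins.fdest <;> simp [h])
    rw [run, run_flags_of_not_mem p _ hf']
    cases ins with
    | copyIn d' o l => rfl
    | setBit d' i => rfl
    | add d' a b sh => rfl
    | andBit d' x i y => rfl
    | lt f' a b => exact update_of_ne (fun e => hf (by subst e; simp [Instr.fdest])) _ _
    | fnot f' g => exact update_of_ne (fun e => hf (by subst e; simp [Instr.fdest])) _ _
    | fand f' g h => exact update_of_ne (fun e => hf (by subst e; simp [Instr.fdest])) _ _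
    | forr f' g h => exact update_of_ne (fun e => hf (by subst e; simp [Instr.fdest])) _ _

variable {Wd inp} {L : Layout} {R F T : ℕ} (hV : L.Valid Wd R F)
include hV

/-- **The invariant along a run**: `p` executed from instruction number `t` (so `t + |p| ≤ T`), all its
destinations fresh in the current state. [folklore] -/
theorem inv_run : ∀ (p : List Instr) (t : ℕ) (st : State) (w : ℕ → Bool),
    Inv L inp R F T (Wd := Wd) t st w → t + p.length ≤ T → (∀ ins ∈ p, ins.Shape Wd L.kIn R F) →
    (p.filterMap Instr.rdest).Nodup → (p.filterMap Instr.fdest).Nodup →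
    (∀ d ∈ p.filterMap Instr.rdest, st.regs d = 0) → (∀ f ∈ p.filterMap Instr.fdest, st.flags f = false) →
    Inv L inp R F T (Wd := Wd) (t + p.length) (run Wd inp st p) (clEval (compileFrom L (Wd := Wd) t p) w)
  | [], t, st, w, hI, _, _, _, _, _, _ => by simpa [run, compileFrom] using hI
  | ins :: p, t, st, w, hI, hT, hsh, hrn, hfn, hr0, hf0 => by
    rw [run, compileFrom, clEval_append, List.length_cons, ← Nat.add_assoc, Nat.add_right_comm]
    have ht : t < T := by simp at hT; omega
    have hshi := hsh ins (by simp)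
    -- the step
    have hstep : Inv L inp R F T (Wd := Wd) (t + 1) (step Wd inp st ins) (clEval (compileInstr L (Wd := Wd) t ins) w) := by
      cases ins with
      | copyIn d off len =>
        obtain ⟨h1, h2, h3⟩ := hshi
        exact inv_step_copyIn hV hI h1 h2 h3 (hr0 d (by simp [Instr.rdest]))
      | setBit d i => exact inv_step_setBit hV hI hshi (hr0 d (by simp [Instr.rdest]))
      | add d a b sh =>
        obtain ⟨h1, h2, h3, h4, h5, h6⟩ := hshi
        exact inv_step_add hV ht hI h1 h2 h3 h4 h5 h6 (hr0 d (by simp [Instr.rdest]))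
      | andBit d x i y =>
        obtain ⟨h1, h2, h3, h4, h5, -, h7⟩ := hshi
        exact inv_step_andBit hV hI h1 h2 h3 h4 h5 h7 (hr0 d (by simp [Instr.rdest]))
      | lt f a b =>
        obtain ⟨h1, h2, h3, h4⟩ := hshi
        exact inv_step_lt hV ht hI h1 h2 h3 h4 (hf0 f (by simp [Instr.fdest]))
      | fnot f g =>
        obtain ⟨h1, h2, h3⟩ := hshi
        exact inv_step_fnot hV hI h1 h2 h3 (hf0 f (by simp [Instr.fdest]))
      | fand f g h =>
        obtain ⟨h1, h2, h3, -, -, -⟩ := hshi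
        exact inv_step_fand hV hI h1 h2 h3 (hf0 f (by simp [Instr.fdest]))
      | forr f g h =>
        obtain ⟨h1, h2, h3, h4, h5, h6⟩ := hshi
        exact inv_step_forr hV hI h1 h2 h3 h4 h5 h6 (hf0 f (by simp [Instr.fdest]))
    -- bookkeeping of destinations
    have hrn' : (p.filterMap Instr.rdest).Nodup ∧ ∀ d ∈ p.filterMap Instr.rdest, ins.rdest ≠ some d := by
      cases h : ins.rdest with
      | none => rw [List.filterMap_cons_none h] at hrn; exact ⟨hrn, fun _ _ e => by cases e⟩
      | some d' =>
        rw [List.filterMap_cons_some h] at hrn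
        exact ⟨(List.nodup_cons.1 hrn).2, fun d hd e => (List.nodup_cons.1 hrn).1 (by cases e; exact hd)⟩
    have hfn' : (p.filterMap Instr.fdest).Nodup ∧ ∀ f ∈ p.filterMap Instr.fdest, ins.fdest ≠ some f := by
      cases h : ins.fdest with
      | none => rw [List.filterMap_cons_none h] at hfn; exact ⟨hfn, fun _ _ e => by cases e⟩
      | some f' =>
        rw [List.filterMap_cons_some h] at hfn
        exact ⟨(List.nodup_cons.1 hfn).2, fun f hf e => (List.nodup_cons.1 hfn).1 (by cases e; exact hf)⟩
    have hsub_r : ∀ d ∈ p.filterMap Instr.rdest, d ∈ (ins :: p).filterMap Instr.rdest := by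
      intro d hd
      cases h : ins.rdest with
      | none => rw [List.filterMap_cons_none h]; exact hd
      | some d' => rw [List.filterMap_cons_some h]; exact List.mem_cons_of_mem _ hd
    have hsub_f : ∀ f ∈ p.filterMap Instr.fdest, f ∈ (ins :: p).filterMap Instr.fdest := by
      intro f hf
      cases h : ins.fdest with
      | none => rw [List.filterMap_cons_none h]; exact hf
      | some f' => rw [List.filterMap_cons_some h]; exact List.mem_cons_of_mem _ hf
    -- the rest
    refine inv_run p (t + 1) _ _ hstep (by simp at hT ⊢; omega) (fun i hi => hsh i (by simp [hi])) hrn'.1 hfn'.1 ?_ ?_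
    · intro d hd
      have hstay : (step Wd inp st ins).regs d = st.regs d := by
        refine run_regs_of_not_mem Wd inp [ins] st fun hmem => ?_
        cases h : ins.rdest with
        | none => rw [List.filterMap_cons_none h] at hmem; simp at hmem
        | some d' =>
          rw [List.filterMap_cons_some h, List.filterMap_nil, List.mem_singleton] at hmem
          exact hrn'.2 d hd (by rw [h, hmem])
      rw [hstay]
      exact hr0 d (hsub_r d hd)
    · intro f hf
      have hstay : (step Wd inp st ins).flags f = st.flags f := by
        refine run_flags_of_not_mem Wd inp [ins] st fun hmem => ?_
        cases h : ins.fdest with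
        | none => rw [List.filterMap_cons_none h] at hmem; simp at hmem
        | some f' =>
          rw [List.filterMap_cons_some h, List.filterMap_nil, List.mem_singleton] at hmem
          exact hfn'.2 f hf (by rw [h, hmem])
      rw [hstay]
      exact hf0 f (hsub_f f hf)

/-- **Compiler correctness.** Let the layout be valid, the program well formed with `|p| ≤ T`
instruction slots, and let the assignment `w` hold the input `inp` on the `kIn` input wires and be
clear on the register block, the flag block and the `T` scratch blocks. Then after the compiled
program every register wire spells the corresponding bit of the interpreted register value, every
flag wire holds the interpreted flag, and the input wires are unchanged. [cite: VedralBarencoEkert1996, §3.1 and §3.3] -/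
theorem clEval_compile {p : List Instr} (hp : ProgWF Wd L.kIn R F p) (hT : p.length ≤ T) {inp : ℕ}
    {w : ℕ → Bool} (hregs : ∀ ρ, ρ < R → ∀ j, j < Wd → w (L.regW (Wd := Wd) ρ j) = false)
    (hflags : ∀ φ, φ < F → w (L.flagW φ) = false) (hscr : ∀ t', t' < T → ∀ o, o < scrSize Wd → w (L.scrW (Wd := Wd) t' o) = false)
    (hinput : ∀ j, j < L.kIn → w (L.iw j) = inp.testBit j) :
    (∀ ρ, ρ < R → ∀ j, j < Wd → clEval (compile L (Wd := Wd) p) w (L.regW (Wd := Wd) ρ j) = ((run Wd inp State.init p).regs ρ).testBit j) ∧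
      (∀ φ, φ < F → clEval (compile L (Wd := Wd) p) w (L.flagW φ) = (run Wd inp State.init p).flags φ) ∧
      (∀ j, j < L.kIn → clEval (compile L (Wd := Wd) p) w (L.iw j) = inp.testBit j) := by
  have hI := inv_run hV p 0 State.init w (inv_init hregs hflags hscr hinput) (by simpa using hT) hp.shape hp.rdest_nodup hp.fdest_nodup
    (fun _ _ => rfl) (fun _ _ => rfl)
  exact ⟨hI.regs, hI.flags, hI.input⟩

end Main

end SLP

end Literature.Computability.QuantumComplexity
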